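/-
Copyright (c) 2026. All rights reserved.
Released under Apache 2.0 license as described in the file LICENSE.
Authors: abc-iut cell, wave-4 seat abc-iut-w4-d085 (L3 sub-DAG Thm 5.4, coordinator assembly of (ii)).
-/
import Literature.AnabelianGeometry.SemiGraphs.ArithMaximalCompactReductions
import Literature.AnabelianGeometry.SemiGraphs.ArithEdgeLikeInfVerticial
import Literature.AnabelianGeometry.SemiGraphs.ArithIntersectionWithGeometricProofs
import Literature.AnabelianGeometry.SemiGraphs.ArithCompactInVerticialConj2
import HarnessLib

/-!
# [SemiAnbd] Theorem 5.4 (ii): assembly from the sub-DAG interface menu (rows T54-1, T54-2, T54-3, T54-4b)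

Mochizuki, *Semi-graphs of anabelioids*, Publ. RIMS **42** (2006), §5, Theorem 5.4 (ii) p. 66
[cite: MochizukiSemiAnbd2006, Thm 5.4 (ii), p. 66]. PROOF-ONLY (no definition): the typed statement
`ArithMaximalCompactStatementII D aug` (abc-iut-L3-t3, `ArithMaximalCompact.lean`) from EXACTLY the inline
hypothesis shapes of the sub-DAG interface menu (HOME/plan/L3/SUBDAG-SemiAnbd-Thm54.md; coordinator file
T54-INTERFACES.md): H-I (Thm 5.4 (i), row T54-3), H-R (Rmk 5.3.1 first sentence, row T54-1), H-geo (Rmk 5.3.1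
second sentence, row T54-2) together with the geometric fact "no geometric verticial subgroup is geometric
edge-like" (Thm 3.7), and the two data-level inputs hβ₁ (every edge-like subgroup lies in two distinct
verticial subgroups), hβ₂ (nested edge-like subgroups are equal) — composing `arithMaximalCompactStatementII_of'`
(`ArithMaximalCompactReductions.lean`) with `not_isEdgeLike_of_isVerticial_of_geometric` and
`exists_eq_inf_of_isEdgeLike` (`ArithEdgeLikeInfVerticial.lean`); and the variant
`arithMaximalCompactStatementII_of_geometric` in which hβ₂ is REPLACED by its derivation
`isEdgeLike_eq_of_le` (abc-iut-w4-d040, `ArithIntersectionWithGeometricProofs.lean`, row T54-2) from the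
commensurator description of the branch decomposition groups (p. 65) and the geometric incomparability of
edge-like subgroups (`TemperedEdgeLikeIncomparable.lean`); and, composing with row T54-3
(abc-iut-w4-d059, `arithMaximalCompactStatementI_of_levelData`, `ArithCompactInVerticialConj2.lean`),
`arithMaximalCompactStatementI_and_II_of_levelData`: Thm 5.4 (i) AND (ii) over arithmetic level data
(trees with `Π^temp_𝔊`-actions, the stabiliser dictionary hfix/hedge, the clause-1 input hconj1 and the
star condition hstar of rows T54-3a/3b) plus the menu inputs of (ii). Nothing here asserts any input.
-/

namespace Literature.AnabelianGeometry.SemiGraphs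

open CategoryTheory

universe v u u' w w'

variable {Gtp : Type u} [Group Gtp] [TopologicalSpace Gtp]
variable {PA : Type u'} [Group PA] [TopologicalSpace PA]
variable {V : Type w} {B : Type w'}
variable {D : DecompositionData Gtp V B} {aug : Gtp →* PA}

/-- **[SemiAnbd] Theorem 5.4 (ii) from the interface menu** (Hausdorff `Π^temp_𝔊`): H-I + H-R + H-geo (+ the
geometric "verticial ≠ edge-like") + hβ₁ + hβ₂ ⟹ `ArithMaximalCompactStatementII D aug`.
[cite: MochizukiSemiAnbd2006, Thm 5.4 (ii), p. 66] -/
theorem arithMaximalCompactStatementII_of_menu [T2Space Gtp] {IsGeomVerticial IsGeomEdgeLike : Subgroup Gtp → Prop}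
    (hI : ArithMaximalCompactStatementI D aug) (hR : VerticialEdgeLikeCompactAmpleStatement D aug)
    (hgeo : IntersectionWithGeometricStatement D aug IsGeomVerticial IsGeomEdgeLike)
    (hne : ∀ K : Subgroup Gtp, IsGeomVerticial K → ¬ IsGeomEdgeLike K)
    (hβ₁ : ∀ K : Subgroup Gtp, IsEdgeLike D K →
      ∃ W₁ W₂ : Subgroup Gtp, IsVerticial D W₁ ∧ IsVerticial D W₂ ∧ W₁ ≠ W₂ ∧ K ≤ W₁ ∧ K ≤ W₂)
    (hβ₂ : ∀ E E' : Subgroup Gtp, IsEdgeLike D E → IsEdgeLike D E' → E ≤ E' → E = E') :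
    Literature.AnabelianGeometry.SemiGraphs.ArithMaximalCompactStatementII D aug :=
  arithMaximalCompactStatementII_of' hI hR
    (fun _ hK => not_isEdgeLike_of_isVerticial_of_geometric hgeo hne hK)
    (fun _ hK => exists_eq_inf_of_isEdgeLike hI hR hβ₁ hβ₂ hK)

/-- Variant with hEV supplied directly (e.g. as a by-product of row T54-3's level-data proof of (i)).
[cite: MochizukiSemiAnbd2006, Thm 5.4 (ii), p. 66] -/
theorem arithMaximalCompactStatementII_of_menu' [T2Space Gtp] {IsGeomVerticial IsGeomEdgeLike : Subgroup Gtp → Prop}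
    (hI : ArithMaximalCompactStatementI D aug) (hR : VerticialEdgeLikeCompactAmpleStatement D aug)
    (hgeo : IntersectionWithGeometricStatement D aug IsGeomVerticial IsGeomEdgeLike)
    (hne : ∀ K : Subgroup Gtp, IsGeomVerticial K → ¬ IsGeomEdgeLike K)
    (hEV : ∀ K : Subgroup Gtp, IsEdgeLike D K →
      ∃ W₁ W₂ : Subgroup Gtp, IsVerticial D W₁ ∧ IsVerticial D W₂ ∧ W₁ ≠ W₂ ∧ K = W₁ ⊓ W₂) :
    Literature.AnabelianGeometry.SemiGraphs.ArithMaximalCompactStatementII D aug :=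
  arithMaximalCompactStatementII_of' hI hR
    (fun _ hK => not_isEdgeLike_of_isVerticial_of_geometric hgeo hne hK) hEV

/-- **[SemiAnbd] Theorem 5.4 (ii) from the menu with hβ₂ DERIVED** (row T54-2, abc-iut-w4-d040
`isEdgeLike_eq_of_le`): inputs H-I, H-R, H-geo, the geometric facts "verticial ≠ edge-like" (`hne`) and
"nested geometric edge-like subgroups are equal" (`hgeomE`), the commensurator description of the branch
decomposition groups `hcomm` (p. 65: "`Π^temp_{𝔊,b}` = the commensurator … of `Π^temp_{𝔾,b}`", definitional for
the produced data) and hβ₁. [cite: MochizukiSemiAnbd2006, Thm 5.4 (ii), p. 66] -/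
theorem arithMaximalCompactStatementII_of_geometric [T2Space Gtp]
    {IsGeomVerticial IsGeomEdgeLike : Subgroup Gtp → Prop}
    (hI : ArithMaximalCompactStatementI D aug) (hR : VerticialEdgeLikeCompactAmpleStatement D aug)
    (hgeo : IntersectionWithGeometricStatement D aug IsGeomVerticial IsGeomEdgeLike)
    (hne : ∀ K : Subgroup Gtp, IsGeomVerticial K → ¬ IsGeomEdgeLike K)
    (hgeomE : ∀ L L' : Subgroup Gtp, IsGeomEdgeLike L → IsGeomEdgeLike L' → L ≤ L' → L = L')
    (hcomm : ∀ b : B, Subgroup.Commensurable.commensurator (D.brGp b ⊓ aug.ker) = D.brGp b)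
    (hβ₁ : ∀ K : Subgroup Gtp, IsEdgeLike D K →
      ∃ W₁ W₂ : Subgroup Gtp, IsVerticial D W₁ ∧ IsVerticial D W₂ ∧ W₁ ≠ W₂ ∧ K ≤ W₁ ∧ K ≤ W₂) :
    Literature.AnabelianGeometry.SemiGraphs.ArithMaximalCompactStatementII D aug :=
  arithMaximalCompactStatementII_of_menu hI hR hgeo hne hβ₁
    (fun _ _ hE hE' hle => isEdgeLike_eq_of_le D aug IsGeomVerticial IsGeomEdgeLike hgeo hcomm hgeomE hE hE' hle)

/-! ### Theorem 5.4 (i) and (ii) together, over arithmetic level data (rows T54-3 + T54-R + T54-4b + T54-2) -/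

section LevelData

variable {J : Type v} [Preorder J] [IsDirectedOrder J]
  (T : J → SemiGraph.{u}) (ρ : ∀ j, Gtp →* Aut (T j)) (f : ∀ ⦃i j : J⦄, i ≤ j → (T j ⟶ T i))

/-- **[SemiAnbd] Theorem 5.4 (i) ∧ (ii) over arithmetic level data**: the binders of
`arithMaximalCompactStatementI_of_levelData` (abc-iut-w4-d059: trees `T j` with `Π^temp_𝔊`-actions `ρ`,
equivariant transitions `f`, no branch switching, the two-sided stabiliser dictionary `hfix`/`hedge`, the
clause-1 input `hconj1`, the star condition `hstar`) give (i); the menu inputs H-R, H-geo, hne, hgeomE,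
hcomm, hβ₁ then give (ii) (`arithMaximalCompactStatementII_of_geometric`).
[cite: MochizukiSemiAnbd2006, Thm 5.4 (i)(ii), p. 66] -/
theorem arithMaximalCompactStatementI_and_II_of_levelData [T2Space Gtp]
    {IsGeomVerticial IsGeomEdgeLike : Subgroup Gtp → Prop}
    (hT : ∀ j, (T j).IsTree)
    (hequiv : ∀ ⦃i j : J⦄ (h : i ≤ j) (g : Gtp) (x : (T j).Vertex),
      (f h).vertexMap ((ρ j g).hom.vertexMap x) = (ρ i g).hom.vertexMap ((f h).vertexMap x))
    (hnoswap : ∀ (j : J) (g : Gtp) (b : (T j).Branch),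
      (ρ j g).hom.edgeMap ((T j).edgeOf b) = (T j).edgeOf b → (ρ j g).hom.branchMap b = b)
    (hfix : ∀ W : Subgroup Gtp, IsVerticial D W → ∃ x : ∀ j, (T j).Vertex,
      (∀ ⦃i j : J⦄ (h : i ≤ j), (f h).vertexMap (x j) = x i) ∧
        ∀ g : Gtp, g ∈ W ↔ ∀ j, (ρ j g).hom.vertexMap (x j) = x j)
    (hedge : ∀ (j₁ : J) (ε : ∀ j : {j : J // j₁ ≤ j}, (T j.1).Edge),
      (∀ ⦃i j : {j : J // j₁ ≤ j}⦄ (h : i.1 ≤ j.1), (f h).edgeMap (ε j) = ε i) →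
      ∃ L : Subgroup Gtp, IsEdgeLike D L ∧
        ∀ g : Gtp, g ∈ L ↔ ∀ j, (ρ j.1 g).hom.edgeMap (ε j) = ε j ∧
          ∀ b : (T j.1).Branch, (T j.1).edgeOf b = ε j → (ρ j.1 g).hom.branchMap b = b)
    (hconj1 : ∀ C : Subgroup Gtp, IsCompact (C : Set Gtp) → IsArithAmple aug C →
      ∃ W : Subgroup Gtp, IsVerticial D W ∧ C ≤ W)
    (hstar : ∀ C : Subgroup Gtp, IsCompact (C : Set Gtp) → IsArithAmple aug C →
      ∀ j : J, ∃ (i : J) (h : j ≤ i), ∀ e e' : (T i).Edge,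
        (∀ γ : C, (ρ i γ).hom.edgeMap e = e) → (∀ γ : C, (ρ i γ).hom.edgeMap e' = e') →
        (f h).edgeMap e = (f h).edgeMap e')
    (hR : VerticialEdgeLikeCompactAmpleStatement D aug)
    (hgeo : IntersectionWithGeometricStatement D aug IsGeomVerticial IsGeomEdgeLike)
    (hne : ∀ K : Subgroup Gtp, IsGeomVerticial K → ¬ IsGeomEdgeLike K)
    (hgeomE : ∀ L L' : Subgroup Gtp, IsGeomEdgeLike L → IsGeomEdgeLike L' → L ≤ L' → L = L')
    (hcomm : ∀ b : B, Subgroup.Commensurable.commensurator (D.brGp b ⊓ aug.ker) = D.brGp b)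
    (hβ₁ : ∀ K : Subgroup Gtp, IsEdgeLike D K →
      ∃ W₁ W₂ : Subgroup Gtp, IsVerticial D W₁ ∧ IsVerticial D W₂ ∧ W₁ ≠ W₂ ∧ K ≤ W₁ ∧ K ≤ W₂) :
    Literature.AnabelianGeometry.SemiGraphs.ArithMaximalCompactStatementI D aug ∧
      Literature.AnabelianGeometry.SemiGraphs.ArithMaximalCompactStatementII D aug := by
  have hI : ArithMaximalCompactStatementI D aug :=
    arithMaximalCompactStatementI_of_levelData D aug T ρ f hT hequiv hnoswap hfix hedge hconj1 hstar
  exact ⟨hI, arithMaximalCompactStatementII_of_geometric hI hR hgeo hne hgeomE hcomm hβ₁⟩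

end LevelData

end Literature.AnabelianGeometry.SemiGraphs
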